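import Mathlib
import Summits.QuantumFields.BalabanUV.Beta.EriceRemainderEnclosureHistoryAutonomyComparisonAgeCompositionStaticChainWindowBounds
import Summits.QuantumFields.BalabanUV.Beta.EriceRemainderEnclosureHistoryAutonomyComparisonAgeCompositionStaticChainAdjacentEnvelopes
import Summits.QuantumFields.BalabanUV.Beta.EriceRemainderEnclosureHistoryAutonomyComparisonAgeCompositionStaticChainBandStepLattice

/-!
# EriceRemainderEnclosureHistoryAutonomyComparisonAgeCompositionStaticChainBandTemplate — (E79j) THE BAND TEMPLATE: the observer step (◆) above EVERY pair
# `(y, z)` of a band `rl·y ≤ z ≤ rh·y`, `y ≥ y0`, `z ≥ z0`, from ONE existential package of rational constants whose facts are quantified over the band —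
# plus the monotone closed-form envelope lemmas (gap antitonicity) that reduce those facts to square-root roundings

Cell `pub-balaban`, β-function sub-cell, BINDER row D4 «RemainderConst leaves for Bałaban's split» (`HOME/BINDER-OWNERS.md`; owner lineage `b2b-balaban-beta-an4`;
this file by co-owner #2 lineage `b2b-balaban-beta-d4-p2`, generation 70), β-FLOW TEAM duty (1), FREEZE (0) honoured (def-free; imports `…WindowBounds` (closed forms),
(E78e) `…AdjacentEnvelopes` (`lam1_ge`, `lam2_ge`, `sqrt_two_bounds`), (E79i) `…BandStepLattice` (`band_step_lattice`); nothing restated).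

HONEST FRAMING (page 1, verbatim and binding).  *"Discharging BetaPertH makes Bałaban's UV stability UNCONDITIONAL — a real constructive-QFT result; it is
NOT the continuum limit and NOT the Clay problem."*  THIS FILE DISCHARGES NOTHING OF THE KIND.  Elementary real analysis of square roots and finite sums —
hypotheses of a census, not facts; the age profile of Bałaban's (1.22) limit functional is NOT PRINTED ([I] p. 298; GAPS G-t4-U2-1∕-2) and NOT asserted.  Row
D4 class UNCHANGED (critical-path width 0; instance 0∕1; D4 DISCHARGE NO DATE).  HONEST DEPENDENCY: continuum YM on T⁴ ⇐ BetaPertH ∧ nine spine estimates (0/9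
proved); BetaPertH ⇐ (D1) ∧ (D4) ∧ CAP+tail; G-an2-4 gates asym, D1 and NE2/3/4.

THE POINT (census sense (α); route (N′); README `HOME/b2b-balaban-beta-d4-p2/g70/e79/README.md` §4).  The transposition of the adjacent pipeline (E79c)–(E79g)
to the non-adjacent pairs: a BAND is `{(y,z) : rl·y ≤ z ≤ rh·y, y ≥ y0, z ≥ z0}`; §2 **`band_pair_step_lattice`** gives the observer step (◆) above every pair of a
band and every configuration from ONE existential package whose envelope facts are quantified over the band; §1 are the lemmas that make such facts one-liners:
`gap_antitone_gen` (`ε ↦ √(a+ε) − √(b+ε)` non-increasing) and the monotone closed forms `band_sigma_lo∕hi`, `band_phi_lo∕hi`, `band_self_lo`, `band_au`, `band_bu`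
(each: closed form of `…WindowBounds` + monotonicity in the band + rational square-root roundings as hypotheses).  TESTED: the generated package for
`r ∈ [9∕20, 1∕2]`, `y ≥ 16` (`g70/numerics/gen_band.py`) elaborates against §2 (scratch `T5.lean`).  NUMERICS (`band2.py`, these exact forms, covariance constant
1): all coefficients positive from `y0 = 16` for the eight bands of width `1∕20` covering `r ∈ [7∕20, 3∕4]` (`q ∈ [1.33, 2.86]`), from `y0 = 24` for
`[3∕10, 7∕20]` and `[3∕4, 4∕5]`; nearer the diagonal (`r > 4∕5`) the band-inflated spread `D = (au−rl)(bu−bl)` pushes the threshold to `y0 ≥ 32–64`, and for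
`r < 3∕10` the bands must narrow or use the `√q`-scaled far treatment with (E79h).  NOT CLAIMED: the packages (E79k…); the small pairs below the thresholds; the
partition∕assembly; anything printed.

WHAT IS PROVED ([folklore]; 0 `def`, 0 sorry).  §1 `gap_antitone_gen`, `band_sigma_lo`, `band_sigma_hi`, `band_phi_lo`, `band_phi_hi`, `band_self_lo`, `band_au`,
`band_bu`.  §2 **`band_pair_step_lattice`**.
-/
noncomputable section
open Finset

namespace Summit.QuantumFields.BalabanUV.Beta.EriceRemainderEnclosureHistoryAutonomyComparisonAgeCompositionStaticChainBandTemplate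

open Summit.QuantumFields.BalabanUV.Beta.EriceRemainderEnclosureHistoryAutonomyComparisonAgeCompositionStaticChainWindowBounds
open Summit.QuantumFields.BalabanUV.Beta.EriceRemainderEnclosureHistoryAutonomyComparisonAgeCompositionStaticChainAdjacentEnvelopes
open Summit.QuantumFields.BalabanUV.Beta.EriceRemainderEnclosureHistoryAutonomyComparisonAgeCompositionStaticChainBandStepLattice

/-! ## §1 Gap antitonicity and the band envelope lemmas -/

/-- `ε ↦ √(a+ε) − √(b+ε)` is non-increasing on `ε ≥ 0` for `0 < b ≤ a` (the gap is `(a−b)∕(√(a+ε)+√(b+ε))`). [folklore] -/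
theorem gap_antitone_gen {a b ε ε₀ : ℝ} (hb : 0 < b) (hab : b ≤ a) (hε : 0 ≤ ε) (hεε : ε ≤ ε₀) :
    Real.sqrt (a + ε₀) - Real.sqrt (b + ε₀) ≤ Real.sqrt (a + ε) - Real.sqrt (b + ε) := by
  have hA := Real.mul_self_sqrt (show 0 ≤ a + ε by linarith)
  have hB := Real.mul_self_sqrt (show 0 ≤ b + ε by linarith)
  have hA0 := Real.mul_self_sqrt (show 0 ≤ a + ε₀ by linarith)
  have hB0 := Real.mul_self_sqrt (show 0 ≤ b + ε₀ by linarith)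
  have pA : 0 < Real.sqrt (a + ε) := Real.sqrt_pos.mpr (by linarith)
  have pB : 0 < Real.sqrt (b + ε) := Real.sqrt_pos.mpr (by linarith)
  have pA0 : 0 < Real.sqrt (a + ε₀) := Real.sqrt_pos.mpr (by linarith)
  have pB0 : 0 < Real.sqrt (b + ε₀) := Real.sqrt_pos.mpr (by linarith)
  have mA : Real.sqrt (a + ε) ≤ Real.sqrt (a + ε₀) := Real.sqrt_le_sqrt (by linarith)
  have mB : Real.sqrt (b + ε) ≤ Real.sqrt (b + ε₀) := Real.sqrt_le_sqrt (by linarith)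
  -- gaps as quotients
  have e1 : Real.sqrt (a + ε) - Real.sqrt (b + ε) = (a - b) / (Real.sqrt (a + ε) + Real.sqrt (b + ε)) := by
    rw [eq_div_iff (by linarith)]; nlinarith
  have e2 : Real.sqrt (a + ε₀) - Real.sqrt (b + ε₀) = (a - b) / (Real.sqrt (a + ε₀) + Real.sqrt (b + ε₀)) := by
    rw [eq_div_iff (by linarith)]; nlinarith
  rw [e1, e2]
  exact div_le_div_of_nonneg_left (by linarith) (by linarith) (by linarith)

/-- Band `σ` lower: for `y ≥ y0 ≥ 1` and `rl·y ≤ z` (`rl ≥ 0`), `S_{y,z} ≥ 2y(√(1+rl+1∕y0) − √(1+1∕y0))` — so `sl·y ≤ S_{y,z}` whenever `L ≤ √(1+rl+1∕y0)`,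
`√(1+1∕y0) ≤ U`, `sl ≤ 2(L−U)`. [folklore] -/
theorem band_sigma_lo {y z y0 : ℕ} {rl L U sl : ℝ} (hy0 : 1 ≤ y0) (hy : y0 ≤ y) (hrl0 : 0 ≤ rl) (hz : rl * (y : ℝ) ≤ z)
    (hL : L ≤ Real.sqrt (1 + rl + 1 / (y0 : ℝ))) (hU : Real.sqrt (1 + 1 / (y0 : ℝ)) ≤ U) (hsl : sl ≤ 2 * (L - U)) :
    sl * (y : ℝ) ≤ ∑ m ∈ range z, Real.sqrt ((y : ℝ) / ((y : ℝ) + m + 1)) := by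
  have hy0' : (1 : ℝ) ≤ y0 := by exact_mod_cast hy0
  have hyy : (y0 : ℝ) ≤ y := by exact_mod_cast hy
  have hk : (0 : ℝ) < y := by linarith
  have h := le_readWindow_ratio hk z
  have h1 : Real.sqrt (1 + rl + 1 / (y : ℝ)) ≤ Real.sqrt (1 + ((z : ℝ) + 1) / (y : ℝ)) := by
    apply Real.sqrt_le_sqrt
    have : rl + 1 / (y : ℝ) ≤ ((z : ℝ) + 1) / (y : ℝ) := by
      rw [le_div_iff₀ hk, add_mul, one_div_mul_cancel hk.ne']; linarith
    linarith
  have h2 := gap_antitone_gen (a := 1 + rl) (b := 1) (ε := 1 / (y : ℝ)) (ε₀ := 1 / (y0 : ℝ)) one_pos (by linarith) (by positivity)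
    (one_div_le_one_div_of_le (by positivity) hyy)
  have hU' : Real.sqrt (1 + 1 / (y : ℝ)) ≤ Real.sqrt (1 + 1 / (y : ℝ)) := le_rfl
  nlinarith [h, h1, h2, hL, hU, hsl, hk]

/-- Band `σ` upper: for `z ≤ rh·y`, `S_{y,z} ≤ 2y(√(1+rh) − 1)` — so `S_{y,z} ≤ su·y` whenever `√(1+rh) ≤ U`, `2(U−1) ≤ su`. [folklore] -/
theorem band_sigma_hi {y z : ℕ} {rh U su : ℝ} (hy : 1 ≤ y) (hz : (z : ℝ) ≤ rh * y) (hU : Real.sqrt (1 + rh) ≤ U) (hsu : 2 * (U - 1) ≤ su) :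
    ∑ m ∈ range z, Real.sqrt ((y : ℝ) / ((y : ℝ) + m + 1)) ≤ su * (y : ℝ) := by
  have hy' : (1 : ℝ) ≤ y := by exact_mod_cast hy
  have hk : (0 : ℝ) < y := by linarith
  have h := readWindow_le_ratio hk z
  have h1 : Real.sqrt (1 + (z : ℝ) / (y : ℝ)) ≤ Real.sqrt (1 + rh) := by
    apply Real.sqrt_le_sqrt; have : (z : ℝ) / (y : ℝ) ≤ rh := by rw [div_le_iff₀ hk]; exact hz
    linarith
  nlinarith [h, h1, hU, hsu, hk]

/-- Band `φ` lower: for `z ≥ z0 ≥ 1` and `ql·z ≤ y`, `S_{z,y} ≥ 2z(√(1+ql+1∕z0) − √(1+1∕z0))` — so `fl·z ≤ S_{z,y}` whenever `L ≤ √(1+ql+1∕z0)`,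
`√(1+1∕z0) ≤ U`, `fl ≤ 2(L−U)` (`ql ≥ 0`). [folklore] -/
theorem band_phi_lo {y z z0 : ℕ} {ql L U fl : ℝ} (hz0 : 1 ≤ z0) (hz : z0 ≤ z) (hql0 : 0 ≤ ql) (hq : ql * (z : ℝ) ≤ y)
    (hL : L ≤ Real.sqrt (1 + ql + 1 / (z0 : ℝ))) (hU : Real.sqrt (1 + 1 / (z0 : ℝ)) ≤ U) (hfl : fl ≤ 2 * (L - U)) :
    fl * (z : ℝ) ≤ ∑ m ∈ range y, Real.sqrt ((z : ℝ) / ((z : ℝ) + m + 1)) :=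
  band_sigma_lo (y := z) (z := y) (y0 := z0) hz0 hz hql0 hq hL hU hfl

/-- Band `φ` upper: for `y ≤ qh·z`, `S_{z,y} ≤ 2z(√(1+qh) − 1)` — so `S_{z,y} ≤ fu·z` whenever `√(1+qh) ≤ U`, `2(U−1) ≤ fu`. [folklore] -/
theorem band_phi_hi {y z : ℕ} {qh U fu : ℝ} (hz : 1 ≤ z) (hq : (y : ℝ) ≤ qh * z) (hU : Real.sqrt (1 + qh) ≤ U) (hfu : 2 * (U - 1) ≤ fu) :
    ∑ m ∈ range y, Real.sqrt ((z : ℝ) / ((z : ℝ) + m + 1)) ≤ fu * (z : ℝ) :=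
  band_sigma_hi (y := z) (z := y) hz hq hU hfu

/-- Band `s` lower: for `y ≥ y0 ≥ 1`, `S_{y,y} ≥ 2y(√(2+1∕y0) − √(1+1∕y0))` — so `slo·y ≤ S_{y,y}` whenever `L ≤ √(2+1∕y0)`, `√(1+1∕y0) ≤ U`,
`slo ≤ 2(L−U)`. [folklore] -/
theorem band_self_lo {y y0 : ℕ} {L U slo : ℝ} (hy0 : 1 ≤ y0) (hy : y0 ≤ y)
    (hL : L ≤ Real.sqrt (2 + 1 / (y0 : ℝ))) (hU : Real.sqrt (1 + 1 / (y0 : ℝ)) ≤ U) (hslo : slo ≤ 2 * (L - U)) :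
    slo * (y : ℝ) ≤ ∑ m ∈ range y, Real.sqrt ((y : ℝ) / ((y : ℝ) + m + 1)) := by
  have h := band_sigma_lo (y := y) (z := y) (y0 := y0) (rl := 1) hy0 hy zero_le_one (by simp) (by rw [show (1:ℝ) + 1 = 2 by norm_num]; exact hL) hU hslo
  exact h

/-- Band charge-ratio end `α₊`: for `y ≥ y0`, `z ≤ rh·y` (`rh ≥ 0`): `S_{y+1,z} ≤ 2(y+1)(√(1+rh) − 1)` and `S_{y+1,y} ≥ 2(y+1)(√2 − √(1+1∕(y0+1)))`, so
`S_{y+1,z} ≤ au·S_{y+1,y}` whenever `√(1+rh) ≤ U`, `A ≤ √2`, `√(1+1∕(y0+1)) ≤ V`, `0 ≤ au`, `U − 1 ≤ au(A − V)`. [folklore] -/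
theorem band_au {y z y0 : ℕ} {rh U A V au : ℝ} (hy : y0 ≤ y) (hrh0 : 0 ≤ rh) (hz : (z : ℝ) ≤ rh * y)
    (hU : Real.sqrt (1 + rh) ≤ U) (hA : A ≤ Real.sqrt 2) (hV : Real.sqrt (1 + 1 / ((y0 : ℝ) + 1)) ≤ V) (hau0 : 0 ≤ au) (hau : U - 1 ≤ au * (A - V)) :
    ∑ m ∈ range z, Real.sqrt (((y : ℝ) + 1) / (((y : ℝ) + 1) + m + 1)) ≤ au * ∑ m ∈ range y, Real.sqrt (((y : ℝ) + 1) / (((y : ℝ) + 1) + m + 1)) := by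
  have hyy : (y0 : ℝ) ≤ y := by exact_mod_cast hy
  have hy0 : (0 : ℝ) ≤ y0 := Nat.cast_nonneg y0
  have hk : (0 : ℝ) < (y : ℝ) + 1 := by linarith
  have h1 := readWindow_le_ratio hk z
  have h2 := le_readWindow_ratio hk y
  have e2 : (1 : ℝ) + ((y : ℝ) + 1) / ((y : ℝ) + 1) = 2 := by field_simp; ring
  rw [e2] at h2
  have h3 : Real.sqrt (1 + (z : ℝ) / ((y : ℝ) + 1)) ≤ Real.sqrt (1 + rh) := by
    apply Real.sqrt_le_sqrt
    have : (z : ℝ) / ((y : ℝ) + 1) ≤ rh := by rw [div_le_iff₀ hk]; nlinarith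
    linarith
  have h4 : Real.sqrt (1 + 1 / ((y : ℝ) + 1)) ≤ Real.sqrt (1 + 1 / ((y0 : ℝ) + 1)) :=
    Real.sqrt_le_sqrt (by have := one_div_le_one_div_of_le (by linarith : (0:ℝ) < (y0:ℝ) + 1) (by linarith : (y0:ℝ) + 1 ≤ (y:ℝ) + 1); linarith)
  have h5 : 2 * ((y : ℝ) + 1) * (U - 1) ≤ 2 * ((y : ℝ) + 1) * (au * (A - V)) := mul_le_mul_of_nonneg_left hau (by positivity)
  have h6 : au * (2 * ((y : ℝ) + 1) * (A - V)) ≤ au * ∑ m ∈ range y, Real.sqrt (((y : ℝ) + 1) / (((y : ℝ) + 1) + m + 1)) :=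
    mul_le_mul_of_nonneg_left (by nlinarith [h2, hA, hV, h4, hk]) hau0
  nlinarith [h1, h3, hU, h5, h6, hk]

/-- Band read-ratio end `β₊`: for `z ≥ z0 ≥ 1`, `y ≤ qh·z`, `y ≥ 1`: `S_{z,y+1} ≤ 2z(√(1+qh+1∕z0) − 1)` and `S_{y,y+1} ≥ 2y(√2 − 1)`, so
`y·S_{z,y+1} ≤ bu·(z·S_{y,y+1})` whenever `√(1+qh+1∕z0) ≤ U`, `A ≤ √2`, `0 ≤ bu`, `U − 1 ≤ bu(A − 1)`. [folklore] -/
theorem band_bu {y z z0 : ℕ} {qh U A bu : ℝ} (hz0 : 1 ≤ z0) (hz : z0 ≤ z) (hq : (y : ℝ) ≤ qh * z) (hy : 1 ≤ y)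
    (hU : Real.sqrt (1 + qh + 1 / (z0 : ℝ)) ≤ U) (hA : A ≤ Real.sqrt 2) (hbu0 : 0 ≤ bu) (hbu : U - 1 ≤ bu * (A - 1)) :
    (y : ℝ) * ∑ m ∈ range (y + 1), Real.sqrt ((z : ℝ) / ((z : ℝ) + m + 1)) ≤ bu * ((z : ℝ) * ∑ m ∈ range (y + 1), Real.sqrt ((y : ℝ) / ((y : ℝ) + m + 1))) := by
  have hz0' : (1 : ℝ) ≤ z0 := by exact_mod_cast hz0
  have hzz : (z0 : ℝ) ≤ z := by exact_mod_cast hz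
  have hy' : (1 : ℝ) ≤ y := by exact_mod_cast hy
  have hk : (0 : ℝ) < z := by linarith
  have hky : (0 : ℝ) < y := by linarith
  have h1 := readWindow_le_ratio hk (y + 1)
  have h2 := le_readWindow_ratio hky (y + 1)
  push_cast at h1 h2
  -- `S_{z,y+1} ≤ 2z(U − 1)`
  have h3 : Real.sqrt (1 + ((y : ℝ) + 1) / (z : ℝ)) ≤ Real.sqrt (1 + qh + 1 / (z0 : ℝ)) := by
    apply Real.sqrt_le_sqrt
    have e : ((y : ℝ) + 1) / (z : ℝ) = (y : ℝ) / z + 1 / z := by rw [add_div]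
    have i1 : (y : ℝ) / z ≤ qh := by rw [div_le_iff₀ hk]; exact hq
    have i2 : 1 / (z : ℝ) ≤ 1 / z0 := one_div_le_one_div_of_le (by linarith) hzz
    linarith
  -- `S_{y,y+1} ≥ 2y(√2 − 1)`: `√(2 + 2/y) − √(1 + 1/y) = √(1+1/y)(√2 − 1) ≥ √2 − 1`
  have e1 : (1 : ℝ) + ((y : ℝ) + 1 + 1) / (y : ℝ) = 2 * (1 + 1 / (y : ℝ)) := by field_simp; ring
  rw [e1, Real.sqrt_mul (by norm_num)] at h2
  have hu1 : 1 ≤ Real.sqrt (1 + 1 / (y : ℝ)) := Real.one_le_sqrt.mpr (by linarith [show (0:ℝ) ≤ 1 / (y:ℝ) by positivity])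
  have hs2 := sqrt_two_bounds.1
  have h4 : 2 * (y : ℝ) * (A - 1) ≤ ∑ m ∈ range (y + 1), Real.sqrt ((y : ℝ) / ((y : ℝ) + m + 1)) := by
    have : (Real.sqrt 2 - 1) * 1 ≤ (Real.sqrt 2 - 1) * Real.sqrt (1 + 1 / (y : ℝ)) := mul_le_mul_of_nonneg_left hu1 (by linarith)
    nlinarith [h2, hA, this, hky]
  have h5 : (y : ℝ) * ∑ m ∈ range (y + 1), Real.sqrt ((z : ℝ) / ((z : ℝ) + m + 1)) ≤ (y : ℝ) * (2 * (z : ℝ) * (U - 1)) :=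
    mul_le_mul_of_nonneg_left (by nlinarith [h1, h3, hU, hk]) hky.le
  have h6 : (y : ℝ) * (2 * (z : ℝ) * (U - 1)) ≤ (y : ℝ) * (2 * (z : ℝ) * (bu * (A - 1))) :=
    mul_le_mul_of_nonneg_left (mul_le_mul_of_nonneg_left hbu (by positivity)) hky.le
  have h7 : bu * ((z : ℝ) * (2 * (y : ℝ) * (A - 1))) ≤ bu * ((z : ℝ) * ∑ m ∈ range (y + 1), Real.sqrt ((y : ℝ) / ((y : ℝ) + m + 1))) :=
    mul_le_mul_of_nonneg_left (mul_le_mul_of_nonneg_left h4 hk.le) hbu0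
  have e4 : (y : ℝ) * (2 * (z : ℝ) * (bu * (A - 1))) = bu * ((z : ℝ) * (2 * (y : ℝ) * (A - 1))) := by ring
  linarith [h5, h6, h7, e4]

/-! ## §2 The band template -/

/-- **THE BAND TEMPLATE.**  Band parameters: `0 ≤ rl`, `rh ≤ 1`, thresholds `y0, z0`, defect envelope `th`.  For ANY pair `(y, z)` of the band (`y0 ≤ y`, `z0 ≤ z`,
`1 ≤ z`, `z+1 ≤ y`, `rl·y ≤ z ≤ rh·y`) and any level-coupled configuration above it (letters of (E79b)∕(E79i): older ages `k_l ≥ y+1`, loads, levels,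
responses, amplifications, window mass, `σ = S_{y,z}∕y`, `φ = S_{z,y}∕z`, `s = S_{y,y}∕y`, defect `θ ≤ th`, load below its cap), the observer step (◆) with
`κ = 31∕40` FOLLOWS FROM ONE EXISTENTIAL PACKAGE `hfacts` of eleven constants whose facts are QUANTIFIED OVER THE BAND: the five envelopes and the two
observer-ratio ends as `∀ y z` in the band (§1 reduces each to square-root roundings), `bl²·rh ≤ 1`, the box roundings, and the eleven polynomial facts of
(E79a) (`l1 = 549∕400`, `l2 = 2071∕1250` from (E78e) `lam1_ge`∕`lam2_ge`).  So every band is ONE ~70-line package and the non-adjacent family closes band by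
band (`g70/numerics/band2.py`: with these exact forms, bands of width `0.05–0.1` in `r` for `q ∈ [1.33, 3.33]` have all coefficients positive from
`y0 = 16–24`; nearer the diagonal and farther out the thresholds rise — README §4).  Proof: (E79i) `band_step_lattice`. [folklore] -/
theorem band_pair_step_lattice {n y z y0 z0 : ℕ} {k : ℕ → ℕ} {x a cy cz Sy Sz Ry Rz : ℕ → ℝ} {θ xy Ψyy Ψyz Ψzy Ψzz Ωz σ φ s rl rh th : ℝ}
    (hrl0 : 0 ≤ rl) (hrh1 : rh ≤ 1) (hy0 : y0 ≤ y) (hz0 : z0 ≤ z) (hz : 1 ≤ z) (hzy : z + 1 ≤ y) (hrl : rl * (y : ℝ) ≤ z) (hrh : (z : ℝ) ≤ rh * y)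
    (hfacts : ∃ sl su fl fu slo au bl bu cl ch D : ℝ,
      0 ≤ sl ∧ (∀ y z : ℕ, y0 ≤ y → z0 ≤ z → rl * (y : ℝ) ≤ z → (z : ℝ) ≤ rh * y → sl * (y : ℝ) ≤ ∑ m ∈ range z, Real.sqrt ((y : ℝ) / ((y : ℝ) + m + 1))) ∧
      (∀ y z : ℕ, y0 ≤ y → z0 ≤ z → rl * (y : ℝ) ≤ z → (z : ℝ) ≤ rh * y → ∑ m ∈ range z, Real.sqrt ((y : ℝ) / ((y : ℝ) + m + 1)) ≤ su * (y : ℝ)) ∧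
      0 ≤ fl ∧ (∀ y z : ℕ, y0 ≤ y → z0 ≤ z → rl * (y : ℝ) ≤ z → (z : ℝ) ≤ rh * y → fl * (z : ℝ) ≤ ∑ m ∈ range y, Real.sqrt ((z : ℝ) / ((z : ℝ) + m + 1))) ∧
      (∀ y z : ℕ, y0 ≤ y → z0 ≤ z → rl * (y : ℝ) ≤ z → (z : ℝ) ≤ rh * y → ∑ m ∈ range y, Real.sqrt ((z : ℝ) / ((z : ℝ) + m + 1)) ≤ fu * (z : ℝ)) ∧
      1 / 2 ≤ slo ∧ (∀ y z : ℕ, y0 ≤ y → z0 ≤ z → rl * (y : ℝ) ≤ z → (z : ℝ) ≤ rh * y → slo * (y : ℝ) ≤ ∑ m ∈ range y, Real.sqrt ((y : ℝ) / ((y : ℝ) + m + 1))) ∧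
      (∀ y z : ℕ, y0 ≤ y → z0 ≤ z → rl * (y : ℝ) ≤ z → (z : ℝ) ≤ rh * y →
        ∑ m ∈ range z, Real.sqrt (((y : ℝ) + 1) / (((y : ℝ) + 1) + m + 1)) ≤ au * ∑ m ∈ range y, Real.sqrt (((y : ℝ) + 1) / (((y : ℝ) + 1) + m + 1))) ∧
      0 ≤ bl ∧ bl ^ 2 * rh ≤ 1 ∧
      (∀ y z : ℕ, y0 ≤ y → z0 ≤ z → rl * (y : ℝ) ≤ z → (z : ℝ) ≤ rh * y →
        (y : ℝ) * ∑ m ∈ range (y + 1), Real.sqrt ((z : ℝ) / ((z : ℝ) + m + 1)) ≤ bu * ((z : ℝ) * ∑ m ∈ range (y + 1), Real.sqrt ((y : ℝ) / ((y : ℝ) + m + 1)))) ∧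
      0 ≤ cl ∧ cl ≤ rl * bl ∧ au * bu ≤ ch ∧ (au - rl) * (bu - bl) ≤ D ∧
      (∀ Ψ : ℝ, 0 ≤ Ψ → 0 ≤ 4 * (31/40:ℝ) * ((549/400:ℝ) + ((2071/1250:ℝ) - rh) * Ψ) * (sl * fl + sl * bl * Ψ + fl * rl * Ψ + Ψ * (cl * Ψ) - D * Ψ ^ 2)
        - (1 + 2 * (31/40:ℝ) * Ψ) * ((1 + 2 * (31/40:ℝ) * (cl * Ψ)) * ((549/400:ℝ) + ((2071/1250:ℝ) - rh) * Ψ) - (1 - th) * ((549/400:ℝ) + (2071/1250:ℝ) * Ψ)) - (1 + 2 * (31/40:ℝ) * (cl * Ψ)) * rh * ((549/400:ℝ) + (2071/1250:ℝ) * Ψ)) ∧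
      (∀ Ψ : ℝ, 0 ≤ Ψ → 0 ≤ 4 * (31/40:ℝ) * ((549/400:ℝ) + ((2071/1250:ℝ) - rh) * Ψ) * (sl * fl + sl * bl * Ψ + fl * rl * Ψ + Ψ * (ch * Ψ) - D * Ψ ^ 2)
        - (1 + 2 * (31/40:ℝ) * Ψ) * ((1 + 2 * (31/40:ℝ) * (ch * Ψ)) * ((549/400:ℝ) + ((2071/1250:ℝ) - rh) * Ψ) - (1 - th) * ((549/400:ℝ) + (2071/1250:ℝ) * Ψ)) - (1 + 2 * (31/40:ℝ) * (ch * Ψ)) * rh * ((549/400:ℝ) + (2071/1250:ℝ) * Ψ)) ∧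
      (∀ Ψ : ℝ, 0 ≤ Ψ → 0 ≤ 4 * (31/40:ℝ) * (sl * fl + sl * bl * Ψ + fl * rl * Ψ + Ψ * (cl * Ψ) - D * Ψ ^ 2)
        - (1 + 2 * (31/40:ℝ) * Ψ) * ((1 + 2 * (31/40:ℝ) * (cl * Ψ)) - (1 - th)) - (1 + 2 * (31/40:ℝ) * (cl * Ψ)) * rh) ∧
      (∀ Ψ : ℝ, 0 ≤ Ψ → 0 ≤ 4 * (31/40:ℝ) * (sl * fl + sl * bl * Ψ + fl * rl * Ψ + Ψ * (ch * Ψ) - D * Ψ ^ 2)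
        - (1 + 2 * (31/40:ℝ) * Ψ) * ((1 + 2 * (31/40:ℝ) * (ch * Ψ)) - (1 - th)) - (1 + 2 * (31/40:ℝ) * (ch * Ψ)) * rh) ∧
      (∀ Ψ : ℝ, 0 ≤ Ψ → 0 ≤ (1 + 2 * (31/40:ℝ) * (cl * Ψ)) * (1 + 2 * (31/40:ℝ) * Ψ) * rl * ((549/400:ℝ) + (2071/1250:ℝ) * Ψ)
        - 4 * (31/40:ℝ) * (su * fu + su * bu * Ψ + fu * au * Ψ + Ψ * (cl * Ψ) + D * Ψ ^ 2) * ((1 + 2 * (31/40:ℝ) * Ψ - 2 * slo - 2 * Ψ) * ((549/400:ℝ) + ((2071/1250:ℝ) - rh) * Ψ) + rl * ((549/400:ℝ) + (2071/1250:ℝ) * Ψ))) ∧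
      (∀ Ψ : ℝ, 0 ≤ Ψ → 0 ≤ (1 + 2 * (31/40:ℝ) * (ch * Ψ)) * (1 + 2 * (31/40:ℝ) * Ψ) * rl * ((549/400:ℝ) + (2071/1250:ℝ) * Ψ)
        - 4 * (31/40:ℝ) * (su * fu + su * bu * Ψ + fu * au * Ψ + Ψ * (ch * Ψ) + D * Ψ ^ 2) * ((1 + 2 * (31/40:ℝ) * Ψ - 2 * slo - 2 * Ψ) * ((549/400:ℝ) + ((2071/1250:ℝ) - rh) * Ψ) + rl * ((549/400:ℝ) + (2071/1250:ℝ) * Ψ))) ∧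
      (∀ Ψ : ℝ, 0 ≤ Ψ → 0 ≤ (1 + 2 * (31/40:ℝ) * (cl * Ψ)) * (1 + 2 * (31/40:ℝ) * Ψ) * rh * ((549/400:ℝ) + (2071/1250:ℝ) * Ψ)
        - 4 * (31/40:ℝ) * (su * fu + su * bu * Ψ + fu * au * Ψ + Ψ * (cl * Ψ) + D * Ψ ^ 2) * ((1 + 2 * (31/40:ℝ) * Ψ - 2 * slo - 2 * Ψ) * ((549/400:ℝ) + ((2071/1250:ℝ) - rh) * Ψ) + rh * ((549/400:ℝ) + (2071/1250:ℝ) * Ψ))) ∧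
      (∀ Ψ : ℝ, 0 ≤ Ψ → 0 ≤ (1 + 2 * (31/40:ℝ) * (ch * Ψ)) * (1 + 2 * (31/40:ℝ) * Ψ) * rh * ((549/400:ℝ) + (2071/1250:ℝ) * Ψ)
        - 4 * (31/40:ℝ) * (su * fu + su * bu * Ψ + fu * au * Ψ + Ψ * (ch * Ψ) + D * Ψ ^ 2) * ((1 + 2 * (31/40:ℝ) * Ψ - 2 * slo - 2 * Ψ) * ((549/400:ℝ) + ((2071/1250:ℝ) - rh) * Ψ) + rh * ((549/400:ℝ) + (2071/1250:ℝ) * Ψ))) ∧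
      (∀ Ψ : ℝ, 0 ≤ Ψ → rh * ((549/400:ℝ) + (2071/1250:ℝ) * Ψ) ≤ 2 * (slo + Ψ) * ((549/400:ℝ) + ((2071/1250:ℝ) - rh) * Ψ)))
    (hn : 0 < n) (hk : ∀ l, l < n → y + 1 ≤ k l) (hx : ∀ l, l < n → 0 ≤ x l)
    (hSy : ∀ l, l < n → Sy l = ∑ m ∈ range y, Real.sqrt ((k l : ℝ) / ((k l : ℝ) + m + 1)))
    (hSz : ∀ l, l < n → Sz l = ∑ m ∈ range z, Real.sqrt ((k l : ℝ) / ((k l : ℝ) + m + 1)))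
    (hRy : ∀ l, l < n → Ry l = ∑ m ∈ range (k l), Real.sqrt ((y : ℝ) / ((y : ℝ) + m + 1)))
    (hRz : ∀ l, l < n → Rz l = ∑ m ∈ range (k l), Real.sqrt ((z : ℝ) / ((z : ℝ) + m + 1)))
    (ha0 : ∀ i, i < n → 0 < a i)
    (ha : ∀ i, i < n → a i = 1 + ∑ l ∈ range n,
      (2 * x l * (∑ m ∈ range (k i), Real.sqrt ((k l : ℝ) / ((k l : ℝ) + m + 1))) / k l) * a l)
    (hcy : ∀ i, i < n → cy i = Ry i / (y : ℝ) + ∑ l ∈ range n,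
      (2 * x l * (∑ m ∈ range (k i), Real.sqrt ((k l : ℝ) / ((k l : ℝ) + m + 1))) / k l) * cy l)
    (hcz : ∀ i, i < n → cz i = Rz i / (z : ℝ) + ∑ l ∈ range n,
      (2 * x l * (∑ m ∈ range (k i), Real.sqrt ((k l : ℝ) / ((k l : ℝ) + m + 1))) / k l) * cz l)
    (hΨyy : Ψyy = ∑ l ∈ range n, (2 * x l * Sy l / k l) * cy l) (hΨyz : Ψyz = ∑ l ∈ range n, (2 * x l * Sz l / k l) * cy l)
    (hΨzy : Ψzy = ∑ l ∈ range n, (2 * x l * Sy l / k l) * cz l) (hΨzz : Ψzz = ∑ l ∈ range n, (2 * x l * Sz l / k l) * cz l)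
    (hΩz : Ωz = ∑ l ∈ range n, x l * (z : ℝ) / k l)
    (hσ : σ = (∑ m ∈ range z, Real.sqrt ((y : ℝ) / ((y : ℝ) + m + 1))) / (y : ℝ))
    (hφ : φ = (∑ m ∈ range y, Real.sqrt ((z : ℝ) / ((z : ℝ) + m + 1))) / (z : ℝ))
    (hs : s = (∑ m ∈ range y, Real.sqrt ((y : ℝ) / ((y : ℝ) + m + 1))) / (y : ℝ))
    (hθ : θ ≤ th) (hxy : 0 ≤ xy) (hcap : 2 * xy * (s + Ψyy) < 1) :
    (1 + 2 * (31/40:ℝ) * Ψzz) * (1 - Ωz) - (1 - θ) * (xy * (1 + 2 * (31/40:ℝ) * Ψyy))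
      ≤ (1 - xy * (1 + 2 * (31/40:ℝ) * Ψyy)) *
        ((1 + 2 * (31/40:ℝ) * Ψzz + 4 * (31/40:ℝ) * xy * ((σ + Ψyz) * (φ + Ψzy)) / (1 - 2 * (s + Ψyy) * xy)) * ((1 - Ωz) - xy / ((y : ℝ) / (z : ℝ)))) := by
  obtain ⟨sl, su, fl, fu, slo, au, bl, bu, cl, ch, D, hsl0, hsl, hsu, hfl0, hfl, hfu, hslo, hslo', hau, hbl0, hbl, hbu, hcl0, hcl, hch, hD,
    hFs_lo, hFs_hi, hF1_lo, hF1_hi, hG_lo_rl, hG_hi_rl, hG_lo_rh, hG_hi_rh, hpole⟩ := hfacts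
  have hy1 : 1 ≤ y := by omega
  have hzp : (0 : ℝ) < z := by exact_mod_cast (show 0 < z by omega)
  have hzy' : (z : ℝ) + 1 ≤ y := by exact_mod_cast hzy
  have hrh0 : 0 < rh := by
    by_contra h
    have : rh * (y : ℝ) ≤ 0 := mul_nonpos_of_nonpos_of_nonneg (not_lt.mp h) (by positivity)
    linarith
  have hl1 := lam1_ge (y := y) hy1
  have hl2 := lam2_ge (y := y) hy1
  have hbl' : bl ^ 2 * (z : ℝ) ≤ y := by
    have := mul_le_mul_of_nonneg_left hrh (sq_nonneg bl)
    nlinarith [mul_le_mul_of_nonneg_right hbl (show (0:ℝ) ≤ y by positivity)]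
  exact band_step_lattice (κ := 31/40) (rl := rl) (rh := rh) (th := th) (l1 := 549/400) (l2 := 2071/1250)
    (sl := sl) (su := su) (fl := fl) (fu := fu) (slo := slo) (au := au) (bl := bl) (bu := bu) (cl := cl) (ch := ch) (D := D)
    (by norm_num) (by norm_num) hn hz hzy hk hx hSy hSz hRy hRz ha0 ha hcy hcz hΨyy hΨyz hΨzy hΨzz hΩz hσ hφ hs hrl0 hrl hrh hθ hxy hcap
    hsl0 (hsl y z hy0 hz0 hrl hrh) (hsu y z hy0 hz0 hrl hrh) hfl0 (hfl y z hy0 hz0 hrl hrh) (hfu y z hy0 hz0 hrl hrh) hslo (hslo' y z hy0 hz0 hrl hrh)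
    (hau y z hy0 hz0 hrl hrh) hbl0 hbl' (hbu y z hy0 hz0 hrl hrh) hcl0 hcl hch hD
    (by norm_num) hl1 (by linarith) hl2
    hFs_lo hFs_hi hF1_lo hF1_hi hG_lo_rl hG_hi_rl hG_lo_rh hG_hi_rh hpole

end Summit.QuantumFields.BalabanUV.Beta.EriceRemainderEnclosureHistoryAutonomyComparisonAgeCompositionStaticChainBandTemplate

end
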